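import Literature.AlgebraicGeometry.HodgeTheory.WeilClassesProductsOfFactors
import Literature.AlgebraicGeometry.HodgeTheory.WeilClassesDescendingTransfer
import Literature.AlgebraicGeometry.HodgeTheory.WeilSurfaceCMSquareAlgebraic
import Literature.AlgebraicGeometry.HodgeTheory.WeilClassesTensorPointAlgebraic
import Literature.AlgebraicGeometry.HodgeTheory.WeilClassesFourfolds
import Literature.AlgebraicGeometry.HodgeTheory.DegreeOneHodgeTypes
import HarnessLib

/-!
# Weil classes: the PAIR elliptic exchange — Weil classes of a product of two odd-dimensional factors
# from the Weil classes of their elliptic completions; sixfolds `Z₁ × Z₂` from Markman's fourfold theorem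

Family `hodge`, layer `Literature/AlgebraicGeometry/HodgeTheory`. Theorems-only companion (plus two factor
permutations, data) of `WeilClassesEllipticExchange` (the `(4,3,3)` tenfold `Y × Z × Z`), built from the same
printed steps on the layer's real carriers: Schoen's product step (`weilClassesOf_prod_le_algebraicClasses`),
the regrouping isomorphism (`weilClassesOf_le_algebraicClasses_of_isogenyPair` at `m = 1`), and ONE Schoen
descent along the CM square `S = (E₀ × E₀, ψ₀ × (-ψ₀))` with its descent partner
(`exists_weilType_cmSquare_partner`, `Schoen1998_weilClasses_algebraic_of_prod_surface_all_holds`).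
No named fact is introduced or discharged.

## What is proved

Let `K = ℚ(√-d)`, `d ≥ 1`, act through endomorphisms of square `-d`: `χ₁` on `Z₁` (dimension `2n₁ - 1`),
`χ₂` on `Z₂` (dimension `2n₂ - 1`), `ψ₀` on a CURVE `E₀`. Write `E = (E₀, ψ₀)`, `Ē = (E₀, -ψ₀)`,
`T = (Z₁ × Z₂, χ₁ × χ₂)` (dimension `2n`, `n + 1 = n₁ + n₂`) and call `F₁ = Z₁ × E = (Z₁ × E₀, χ₁ × ψ₀)`
and `F₂ = Z₂ × Ē = (Z₂ × E₀, χ₂ × (-ψ₀))` the ELLIPTIC COMPLETIONS of the two factors (dimensions `2n₁`, `2n₂`).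

* `weilClasses_ellipticExchange_pair`: **if the Weil planes `weilClassesOf F₁ (χ₁ × ψ₀) n₁ d` and
  `weilClassesOf F₂ (χ₂ × (-ψ₀)) n₂ d` consist of algebraic classes, then every rational class of Hodge type
  `(n,n)` in the Weil plane `weilClassesOf T (χ₁ × χ₂) n d` is algebraic.**  Proof: (1) PRODUCT — the Weil plane
  of `F₁ × F₂` (level `n₁ + n₂ = n + 1`) is algebraic; (2) REGROUP — the factor permutation
  `T × S = (Z₁ × Z₂) × (E₀ × E₀) ≅ (Z₁ × E₀) × (Z₂ × E₀) = F₁ × F₂` intertwines `(χ₁ × χ₂) × (ψ₀ × (-ψ₀))` with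
  `(χ₁ × ψ₀) × (χ₂ × (-ψ₀))`, so the Weil plane of `T × S` is algebraic; (3) DESCEND once along `S`.
* `weilClasses_ellipticExchange_three_three`: the case `n₁ = n₂ = 2`, `n = 3` — two THREEFOLDS, a sixfold `T`,
  fourfold completions.
* `weilClasses_threefold_prod_threefold_of_markman`: **given Markman's fourfold theorem
  (`Markman2025_weilClasses_algebraic_abelianFourfold`, a named fact of the layer taken as a hypothesis exactly as
  elsewhere in the layer) and completions `F₁`, `F₂` OF WEIL TYPE (`K`-multiplicity `2` of `i√d` on `H^{1,0}`),
  every rational `(3,3)`-class of the Weil plane of `Z₁ × Z₂` is algebraic.**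
* `weilClasses_threefold_prod_threefold_of_markman_of_multiplicities` — the same with the multiplicities read on
  the FACTORS: `(Z₁, χ₁)` of `K`-type `(1,2)`, `(Z₂, χ₂)` of type `(2,1)`, `(E₀, ψ₀)` of type `(1,0)` (then
  `(E₀, -ψ₀)` has type `(0,1)`, `finrank_eigenspace_neg_inf_hodgeOneZero_eq_zero_of_curve`, and multiplicities
  add over products, `finrank_eigenspace_inf_hodgeOneZero_prod`); and
  `weilClassesOf_threefold_prod_threefold_le_algebraicClasses_of_markman` — **the whole Weil plane of the
  sixfold `(Z₁ × Z₂, χ₁ × χ₂)` (of Weil type `(3,3)`) consists of algebraic classes.**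

WHY (cell `pub-hodgecm2`, COR-CM, seat b30; count-neutral): `WeilClassesTwistedSquare` makes the Weil classes of
`(Z × Z, χ × (-χ))` algebraic unconditionally for ONE factor `Z`; the pair exchange handles two DIFFERENT
odd-dimensional factors at the price of the completions — for threefolds Markman's FOURFOLD theorem, with no
discriminant / splitness condition on the sixfold.  Consumers: products `B₁ × B₂` of non-isogenous CM threefolds
whose (possibly different) sextic CM fields contain one imaginary quadratic field (e.g. the Galois-conjugate
simple threefolds of a NON-Galois sextic CM field `k·F₀`), outside the Galois-sextic rung `CorCM/CyclicSextic*`.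

## References

* [Schoen1998HodgeWeilAddendum] C. Schoen, Addendum to: Hodge classes on self-products of a variety with an
  automorphism, Compositio Math. 114 (1998) 329–336, §10 (Proposition and proof, pp. 332–333).
* [Deligne1982HodgeCycles] P. Deligne (notes by J. S. Milne), Hodge cycles on abelian varieties, LNM 900, §5 (c).
* [MoonenZarhin1998WeilClasses] B. Moonen, Yu. Zarhin, J. reine angew. Math. 496 (1998), p. 2.
* [vanGeemen1994HodgeAV] B. van Geemen, LNM 1594 (1994), 4.9, 4.10, Lemma 5.2, 5.7.
* [LangeBirkenhake1992] H. Lange, Ch. Birkenhake, Complex Abelian Varieties (1992), §1.1.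
* [Markman2025SurveySecant] E. Markman, arXiv:2509.23403, Thm. 1.2, §11.5 Steps 1–2.
-/

noncomputable section

open CategoryTheory

namespace Literature.AlgebraicGeometry.HodgeTheory

open Literature.AlgebraicTopology.SingularHomology
open Literature.AlgebraicGeometry.Motives (IsSmoothProjective)
open Motives.AbelianVariety (prodLift prodLift_fst prodLift_snd prodLift_fst_assoc prodLift_snd_assoc
  prod_hom_ext)

section Shuffle

/-! ### The factor permutation `(Z₁ × Z₂) × (C₁ × C₂) ≅ (Z₁ × C₁) × (Z₂ × C₂)` -/

variable (Z₁ Z₂ C₁ C₂ : Motives.AbelianVariety ℂ)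

/-- The factor permutation `((z₁, z₂), (c₁, c₂)) ↦ ((z₁, c₁), (z₂, c₂))` (a homomorphism of abelian varieties,
built from the projections). [folklore] -/
def pairExchangeHom : (Z₁.prod Z₂).prod (C₁.prod C₂) ⟶ (Z₁.prod C₁).prod (Z₂.prod C₂) :=
  prodLift
    (prodLift
      (Motives.AbelianVariety.fst (Z₁.prod Z₂) (C₁.prod C₂) ≫ Motives.AbelianVariety.fst Z₁ Z₂)
      (Motives.AbelianVariety.snd (Z₁.prod Z₂) (C₁.prod C₂) ≫ Motives.AbelianVariety.fst C₁ C₂))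
    (prodLift
      (Motives.AbelianVariety.fst (Z₁.prod Z₂) (C₁.prod C₂) ≫ Motives.AbelianVariety.snd Z₁ Z₂)
      (Motives.AbelianVariety.snd (Z₁.prod Z₂) (C₁.prod C₂) ≫ Motives.AbelianVariety.snd C₁ C₂))

/-- The inverse factor permutation `((z₁, c₁), (z₂, c₂)) ↦ ((z₁, z₂), (c₁, c₂))`. [folklore] -/
def pairExchangeInv : (Z₁.prod C₁).prod (Z₂.prod C₂) ⟶ (Z₁.prod Z₂).prod (C₁.prod C₂) :=
  prodLift
    (prodLift
      (Motives.AbelianVariety.fst (Z₁.prod C₁) (Z₂.prod C₂) ≫ Motives.AbelianVariety.fst Z₁ C₁)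
      (Motives.AbelianVariety.snd (Z₁.prod C₁) (Z₂.prod C₂) ≫ Motives.AbelianVariety.fst Z₂ C₂))
    (prodLift
      (Motives.AbelianVariety.fst (Z₁.prod C₁) (Z₂.prod C₂) ≫ Motives.AbelianVariety.snd Z₁ C₁)
      (Motives.AbelianVariety.snd (Z₁.prod C₁) (Z₂.prod C₂) ≫ Motives.AbelianVariety.snd Z₂ C₂))

/-- `hom ≫ inv = 𝟙`. [folklore] -/
private theorem pairExchangeHom_comp_inv :
    pairExchangeHom Z₁ Z₂ C₁ C₂ ≫ pairExchangeInv Z₁ Z₂ C₁ C₂ = 𝟙 _ := by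
  refine prod_hom_ext (prod_hom_ext ?_ ?_) (prod_hom_ext ?_ ?_) <;>
  simp only [pairExchangeHom, pairExchangeInv, Category.assoc, Category.id_comp,
    prodLift_fst, prodLift_snd, prodLift_fst_assoc, prodLift_snd_assoc]

/-- `inv ≫ hom = 𝟙`. [folklore] -/
private theorem pairExchangeInv_comp_hom :
    pairExchangeInv Z₁ Z₂ C₁ C₂ ≫ pairExchangeHom Z₁ Z₂ C₁ C₂ = 𝟙 _ := by
  refine prod_hom_ext (prod_hom_ext ?_ ?_) (prod_hom_ext ?_ ?_) <;>
  simp only [pairExchangeHom, pairExchangeInv, Category.assoc, Category.id_comp,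
    prodLift_fst, prodLift_snd, prodLift_fst_assoc, prodLift_snd_assoc]

/-- The factor permutation is flat (it is an isomorphism of the underlying schemes). [folklore] -/
private theorem flat_pairExchangeHom :
    _root_.AlgebraicGeometry.Flat (pairExchangeHom Z₁ Z₂ C₁ C₂).hom.hom.hom.left := by
  have h1 := congrArg (fun f : _ ⟶ (Z₁.prod Z₂).prod (C₁.prod C₂) ↦ f.hom.hom.hom.left)
    (pairExchangeHom_comp_inv Z₁ Z₂ C₁ C₂)
  have h2 := congrArg (fun f : _ ⟶ (Z₁.prod C₁).prod (Z₂.prod C₂) ↦ f.hom.hom.hom.left)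
    (pairExchangeInv_comp_hom Z₁ Z₂ C₁ C₂)
  haveI : IsIso (pairExchangeHom Z₁ Z₂ C₁ C₂).hom.hom.hom.left :=
    ⟨⟨(pairExchangeInv Z₁ Z₂ C₁ C₂).hom.hom.hom.left, h1, h2⟩⟩
  exact MorphismProperty.of_isIso @_root_.AlgebraicGeometry.Flat _

variable {Z₁ Z₂ C₁ C₂}

/-- The factor permutation intertwines the diagonal endomorphisms: with `χᵢ` on `Zᵢ` and `γᵢ` on `Cᵢ`,
`inv ≫ ((χ₁ × χ₂) × (γ₁ × γ₂)) = ((χ₁ × γ₁) × (χ₂ × γ₂)) ≫ inv`. [folklore] -/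
private theorem pairExchangeInv_comm (χ₁ : Z₁ ⟶ Z₁) (χ₂ : Z₂ ⟶ Z₂) (γ₁ : C₁ ⟶ C₁) (γ₂ : C₂ ⟶ C₂) :
    pairExchangeInv Z₁ Z₂ C₁ C₂ ≫
        prodLift
          (Motives.AbelianVariety.fst (Z₁.prod Z₂) (C₁.prod C₂) ≫
            prodLift (Motives.AbelianVariety.fst Z₁ Z₂ ≫ χ₁) (Motives.AbelianVariety.snd Z₁ Z₂ ≫ χ₂))
          (Motives.AbelianVariety.snd (Z₁.prod Z₂) (C₁.prod C₂) ≫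
            prodLift (Motives.AbelianVariety.fst C₁ C₂ ≫ γ₁) (Motives.AbelianVariety.snd C₁ C₂ ≫ γ₂)) =
      prodLift
          (Motives.AbelianVariety.fst (Z₁.prod C₁) (Z₂.prod C₂) ≫
            prodLift (Motives.AbelianVariety.fst Z₁ C₁ ≫ χ₁) (Motives.AbelianVariety.snd Z₁ C₁ ≫ γ₁))
          (Motives.AbelianVariety.snd (Z₁.prod C₁) (Z₂.prod C₂) ≫
            prodLift (Motives.AbelianVariety.fst Z₂ C₂ ≫ χ₂) (Motives.AbelianVariety.snd Z₂ C₂ ≫ γ₂)) ≫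
        pairExchangeInv Z₁ Z₂ C₁ C₂ := by
  refine prod_hom_ext (prod_hom_ext ?_ ?_) (prod_hom_ext ?_ ?_) <;>
  simp only [pairExchangeInv, Category.assoc, prodLift_fst, prodLift_snd, prodLift_fst_assoc,
    prodLift_snd_assoc]

end Shuffle

section PairExchange

/-! ### The pair elliptic exchange -/
variable {Z₁ Z₂ E₀ : Motives.AbelianVariety ℂ} {d : ℕ} {χ₁ : Z₁ ⟶ Z₁} {χ₂ : Z₂ ⟶ Z₂} {ψ₀ : E₀ ⟶ E₀}

/-- `(-ψ₀) ≫ (-ψ₀) = ψ₀ ≫ ψ₀`. [folklore] -/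
private theorem neg_comp_neg_eq_neg_nsmul' (hψ₀ : ψ₀ ≫ ψ₀ = -(d • 𝟙 E₀)) :
    (-ψ₀) ≫ (-ψ₀) = -(d • 𝟙 E₀) := by
  rw [Preadditive.neg_comp, Preadditive.comp_neg, neg_neg, hψ₀]

/-- **The pair elliptic exchange** (Schoen 1998 §10 run backwards along the CM square; Deligne LNM 900 §5 (c);
Moonen–Zarhin 1998 p. 2).  `K = ℚ(√-d)` acting by `χ₁` on `Z₁` (`dim Z₁ + 1 = 2n₁`), by `χ₂` on `Z₂`
(`dim Z₂ + 1 = 2n₂`), by `ψ₀` on the curve `E₀`; `T = Z₁ × Z₂` with `χ₁ × χ₂` (`dim T = 2n`, `n₁ + n₂ = n + 1`);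
completions `F₁ = Z₁ × E₀` with `χ₁ × ψ₀` and `F₂ = Z₂ × E₀` with `χ₂ × (-ψ₀)`.  If the Weil planes of `F₁`
(level `n₁`) and `F₂` (level `n₂`) consist of algebraic classes, then every rational `(n,n)`-class of the Weil
plane of `T` (level `n`) is algebraic.  PROVENANCE: the statement is the COMPOSITION (this layer's) of the cited
printed steps — Schoen's product step and his descent along a Weil-type surface (§10), applied to Deligne's
CM padding `E × Ē` (§5 (c)) — and is not itself a numbered result of the sources; each citation tag names
exactly the step it formalises, and the proof is unconditional on the carriers.
[cite: Schoen1998HodgeWeilAddendum, §10 (Proposition and proof, pp. 332–333)]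
[cite: Deligne1982HodgeCycles, §5 (c) and (4.8)] [cite: MoonenZarhin1998WeilClasses, p. 2] -/
theorem weilClasses_ellipticExchange_pair {n₁ n₂ n : ℕ} (hn : n₁ + n₂ = n + 1) (hd : 0 < d)
    (hZ₁ : Z₁.dim + 1 = 2 * n₁) (hZ₂ : Z₂.dim + 1 = 2 * n₂) (hE : E₀.dim = 1)
    (hχ₁ : χ₁ ≫ χ₁ = -(d • 𝟙 Z₁)) (hχ₂ : χ₂ ≫ χ₂ = -(d • 𝟙 Z₂)) (hψ₀ : ψ₀ ≫ ψ₀ = -(d • 𝟙 E₀))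
    (hF₁ : weilClassesOf (Z₁.prod E₀)
        (prodLift (Motives.AbelianVariety.fst Z₁ E₀ ≫ χ₁) (Motives.AbelianVariety.snd Z₁ E₀ ≫ ψ₀)) n₁ d ≤
      algebraicClasses (Z₁.prod E₀).X n₁)
    (hF₂ : weilClassesOf (Z₂.prod E₀)
        (prodLift (Motives.AbelianVariety.fst Z₂ E₀ ≫ χ₂) (Motives.AbelianVariety.snd Z₂ E₀ ≫ (-ψ₀))) n₂ d ≤
      algebraicClasses (Z₂.prod E₀).X n₂) :
    ∀ c : complexBetti (Z₁.prod Z₂).X (2 * n), IsRationalClass c →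
      IsOfHodgeType (2 * n) (Z₁.prod Z₂).X (2 * n) n n c →
        c ∈ weilClassesOf (Z₁.prod Z₂)
          (prodLift (Motives.AbelianVariety.fst Z₁ Z₂ ≫ χ₁) (Motives.AbelianVariety.snd Z₁ Z₂ ≫ χ₂)) n d →
        c ∈ algebraicClasses (Z₁.prod Z₂).X n := by
  -- the CM square `S = (E₀ × E₀, ψ₀ × (-ψ₀))` with its descent partner
  obtain ⟨hSd, hSsp, hΦ, hpartner⟩ := exists_weilType_cmSquare_partner hE hd hψ₀
  have hnψ₀ := neg_comp_neg_eq_neg_nsmul' hψ₀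
  -- squares of the diagonal endomorphisms
  have hφT := prodLift_comp_self_eq_neg_nsmul hχ₁ hχ₂
  have hφTS := prodLift_comp_self_eq_neg_nsmul hφT hΦ
  have hφF₁ := prodLift_comp_self_eq_neg_nsmul hχ₁ hψ₀
  have hφF₂ := prodLift_comp_self_eq_neg_nsmul hχ₂ hnψ₀
  have hφR := prodLift_comp_self_eq_neg_nsmul hφF₁ hφF₂
  -- dimensions
  have hn₁ : 0 < n₁ := by omega
  have hn0 : 0 < n := by omega
  have hTd : (Z₁.prod Z₂).dim = 2 * n := by
    rw [Motives.AbelianVariety.dim_prod]; omega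
  have hTSd : ((Z₁.prod Z₂).prod (E₀.prod E₀)).dim = 2 * (n + 1) := by
    rw [Motives.AbelianVariety.dim_prod, hTd, hSd]; omega
  have hF₁d : (Z₁.prod E₀).dim = 2 * n₁ := by
    rw [Motives.AbelianVariety.dim_prod, hE]; exact hZ₁
  have hF₂d : (Z₂.prod E₀).dim = 2 * n₂ := by
    rw [Motives.AbelianVariety.dim_prod, hE]; exact hZ₂
  have hRd : ((Z₁.prod E₀).prod (Z₂.prod E₀)).dim = 2 * (n + 1) := by
    rw [Motives.AbelianVariety.dim_prod, hF₁d, hF₂d]; omega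
  -- (1) PRODUCT: the Weil plane of `F₁ × F₂` (level `n₁ + n₂`) is algebraic
  have hWR := weilClassesOf_prod_le_algebraicClasses hn₁ hd hF₁d hF₂d hφF₁ hφF₂ hF₁ hF₂
  rw [hn] at hWR
  -- (2) REGROUP: `T × S ≅ F₁ × F₂` intertwining the structures; an iso is flat
  haveI := flat_pairExchangeHom Z₁ Z₂ E₀ E₀
  have hWL : weilClassesOf ((Z₁.prod Z₂).prod (E₀.prod E₀))
      (prodLift
        (Motives.AbelianVariety.fst (Z₁.prod Z₂) (E₀.prod E₀) ≫
          prodLift (Motives.AbelianVariety.fst Z₁ Z₂ ≫ χ₁) (Motives.AbelianVariety.snd Z₁ Z₂ ≫ χ₂))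
        (Motives.AbelianVariety.snd (Z₁.prod Z₂) (E₀.prod E₀) ≫
          prodLift (Motives.AbelianVariety.fst E₀ E₀ ≫ ψ₀) (Motives.AbelianVariety.snd E₀ E₀ ≫ (-ψ₀))))
      (n + 1) d ≤ algebraicClasses ((Z₁.prod Z₂).prod (E₀.prod E₀)).X (n + 1) :=
    weilClassesOf_le_algebraicClasses_of_isogenyPair (Motives.isSmoothProjective_of_dim_eq' hTSd)
      (Motives.isSmoothProjective_of_dim_eq' hRd) (pairExchangeHom Z₁ Z₂ E₀ E₀)
      (pairExchangeInv Z₁ Z₂ E₀ E₀) (pairExchangeInv_comm χ₁ χ₂ ψ₀ (-ψ₀))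
      one_pos (by rw [one_nsmul]; exact pairExchangeHom_comp_inv Z₁ Z₂ E₀ E₀) hWR
  -- (3) DESCEND once along the CM square
  exact Schoen1998_weilClasses_algebraic_of_prod_surface_all_holds n hn0 d hd
    (Z₁.prod Z₂) _ (E₀.prod E₀) _ hTd (Motives.isSmoothProjective_of_dim_eq' hTd) hφT hSd hSsp
    hΦ hpartner (fun c _ _ hcW ↦ hWL hcW)

/-- **The pair elliptic exchange for two THREEFOLDS** (`n₁ = n₂ = 2`, `n = 3`): `Z₁`, `Z₂` of dimension `3`,
`T = Z₁ × Z₂` a sixfold, completions `F₁ = (Z₁ × E₀, χ₁ × ψ₀)`, `F₂ = (Z₂ × E₀, χ₂ × (-ψ₀))` FOURFOLDS: if their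
Weil planes (level `2`) consist of algebraic classes, every rational `(3,3)`-class of the Weil plane of `T` is
algebraic. [cite: Schoen1998HodgeWeilAddendum, §10 (Proposition and proof, pp. 332–333)]
[cite: Deligne1982HodgeCycles, §5 (c) and (4.8)] -/
theorem weilClasses_ellipticExchange_three_three (hd : 0 < d) (hZ₁ : Z₁.dim = 3) (hZ₂ : Z₂.dim = 3)
    (hE : E₀.dim = 1) (hχ₁ : χ₁ ≫ χ₁ = -(d • 𝟙 Z₁)) (hχ₂ : χ₂ ≫ χ₂ = -(d • 𝟙 Z₂))
    (hψ₀ : ψ₀ ≫ ψ₀ = -(d • 𝟙 E₀))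
    (hF₁ : weilClassesOf (Z₁.prod E₀)
        (prodLift (Motives.AbelianVariety.fst Z₁ E₀ ≫ χ₁) (Motives.AbelianVariety.snd Z₁ E₀ ≫ ψ₀)) 2 d ≤
      algebraicClasses (Z₁.prod E₀).X 2)
    (hF₂ : weilClassesOf (Z₂.prod E₀)
        (prodLift (Motives.AbelianVariety.fst Z₂ E₀ ≫ χ₂) (Motives.AbelianVariety.snd Z₂ E₀ ≫ (-ψ₀))) 2 d ≤
      algebraicClasses (Z₂.prod E₀).X 2) :
    ∀ c : complexBetti (Z₁.prod Z₂).X (2 * 3), IsRationalClass c →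
      IsOfHodgeType (2 * 3) (Z₁.prod Z₂).X (2 * 3) 3 3 c →
        c ∈ weilClassesOf (Z₁.prod Z₂)
          (prodLift (Motives.AbelianVariety.fst Z₁ Z₂ ≫ χ₁) (Motives.AbelianVariety.snd Z₁ Z₂ ≫ χ₂)) 3 d →
        c ∈ algebraicClasses (Z₁.prod Z₂).X 3 :=
  weilClasses_ellipticExchange_pair (n₁ := 2) (n₂ := 2) (n := 3) rfl hd (by rw [hZ₁]) (by rw [hZ₂]) hE
    hχ₁ hχ₂ hψ₀ hF₁ hF₂

end PairExchange

section Markman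

/-! ### Sixfolds `Z₁ × Z₂` from Markman's fourfold theorem -/
variable {Z₁ Z₂ E₀ : Motives.AbelianVariety ℂ} {d : ℕ} {χ₁ : Z₁ ⟶ Z₁} {χ₂ : Z₂ ⟶ Z₂} {ψ₀ : E₀ ⟶ E₀}

/-- **Weil classes on a product of two threefolds, from Markman's fourfold theorem.**  `K = ℚ(√-d)` acting by
`χ₁, χ₂, ψ₀` (squares `-d`) on threefolds `Z₁, Z₂` and a curve `E₀`; assume the elliptic completions
`F₁ = (Z₁ × E₀, χ₁ × ψ₀)` and `F₂ = (Z₂ × E₀, χ₂ × (-ψ₀))` are OF WEIL TYPE (`i√d` has multiplicity `2` on `H^{1,0}`;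
van Geemen 4.9).  Then, GIVEN `Markman2025_weilClasses_algebraic_abelianFourfold` (Weil classes on abelian
fourfolds of Weil type are algebraic, every `K`, every discriminant), every rational `(3,3)`-class of the Weil
plane of `(Z₁ × Z₂, χ₁ × χ₂)` is algebraic — no discriminant or splitness condition on the sixfold.
[cite: Markman2025SurveySecant, Thm. 1.2 and §11.5 Step 2] [cite: vanGeemen1994HodgeAV, 4.9 and Lemma 5.2]
[cite: Schoen1998HodgeWeilAddendum, §10 (Proposition and proof, pp. 332–333)] -/
theorem weilClasses_threefold_prod_threefold_of_markman (hW4 : Markman2025_weilClasses_algebraic_abelianFourfold)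
    (hd : 0 < d) (hZ₁ : Z₁.dim = 3) (hZ₂ : Z₂.dim = 3) (hE : E₀.dim = 1)
    (hχ₁ : χ₁ ≫ χ₁ = -(d • 𝟙 Z₁)) (hχ₂ : χ₂ ≫ χ₂ = -(d • 𝟙 Z₂)) (hψ₀ : ψ₀ ≫ ψ₀ = -(d • 𝟙 E₀))
    (hbal₁ : Module.finrank ℂ ↥(Module.End.eigenspace (complexBetti.map
          (prodLift (Motives.AbelianVariety.fst Z₁ E₀ ≫ χ₁) (Motives.AbelianVariety.snd Z₁ E₀ ≫ ψ₀)).hom.hom.hom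
          1).hom (Complex.I * (Real.sqrt d : ℂ)) ⊓
        hodgeOneZero (Motives.isSmoothProjective_of_dim_eq'
          (show (Z₁.prod E₀).dim = 2 * 2 by rw [Motives.AbelianVariety.dim_prod, hZ₁, hE]))) = 2)
    (hbal₂ : Module.finrank ℂ ↥(Module.End.eigenspace (complexBetti.map
          (prodLift (Motives.AbelianVariety.fst Z₂ E₀ ≫ χ₂) (Motives.AbelianVariety.snd Z₂ E₀ ≫ (-ψ₀))).hom.hom.hom
          1).hom (Complex.I * (Real.sqrt d : ℂ)) ⊓
        hodgeOneZero (Motives.isSmoothProjective_of_dim_eq'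
          (show (Z₂.prod E₀).dim = 2 * 2 by rw [Motives.AbelianVariety.dim_prod, hZ₂, hE]))) = 2) :
    ∀ c : complexBetti (Z₁.prod Z₂).X (2 * 3), IsRationalClass c →
      IsOfHodgeType (2 * 3) (Z₁.prod Z₂).X (2 * 3) 3 3 c →
        c ∈ weilClassesOf (Z₁.prod Z₂)
          (prodLift (Motives.AbelianVariety.fst Z₁ Z₂ ≫ χ₁) (Motives.AbelianVariety.snd Z₁ Z₂ ≫ χ₂)) 3 d →
        c ∈ algebraicClasses (Z₁.prod Z₂).X 3 := by
  have hψ₀' : (-ψ₀) ≫ (-ψ₀) = -(d • 𝟙 E₀) := by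
    rw [Preadditive.neg_comp, Preadditive.comp_neg, neg_neg, hψ₀]
  have hF₁d : (Z₁.prod E₀).dim = 2 * 2 := by rw [Motives.AbelianVariety.dim_prod, hZ₁, hE]
  have hF₂d : (Z₂.prod E₀).dim = 2 * 2 := by rw [Motives.AbelianVariety.dim_prod, hZ₂, hE]
  have hφF₁ := prodLift_comp_self_eq_neg_nsmul hχ₁ hψ₀
  have hφF₂ := prodLift_comp_self_eq_neg_nsmul hχ₂ hψ₀'
  have hF₁ := weilClassesOf_le_algebraicClasses_of_forall_isRationalClass two_pos hF₁d hd hφF₁ hbal₁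
    (hW4 d hd _ _ hF₁d (Motives.isSmoothProjective_of_dim_eq' hF₁d) hφF₁)
  have hF₂ := weilClassesOf_le_algebraicClasses_of_forall_isRationalClass two_pos hF₂d hd hφF₂ hbal₂
    (hW4 d hd _ _ hF₂d (Motives.isSmoothProjective_of_dim_eq' hF₂d) hφF₂)
  exact weilClasses_ellipticExchange_three_three hd hZ₁ hZ₂ hE hχ₁ hχ₂ hψ₀ hF₁ hF₂

/-! ### Multiplicities read on the factors -/

/-- The eigenspace of `(-ψ)^* = -ψ^*` for `μ` is the eigenspace of `ψ^*` for `-μ` (on `H¹`).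
[cite: LangeBirkenhake1992, §1.1] -/
private theorem eigenspace_map_neg_deg_one (ψ : E₀ ⟶ E₀) (μ : ℂ) :
    Module.End.eigenspace (complexBetti.map (-ψ).hom.hom.hom 1).hom μ =
      Module.End.eigenspace (complexBetti.map ψ.hom.hom.hom 1).hom (-μ) := by
  ext v
  simp only [Module.End.mem_eigenspace_iff]
  change complexBetti.map (-ψ).hom.hom.hom 1 v = μ • v ↔ complexBetti.map ψ.hom.hom.hom 1 v = -μ • v
  rw [complexBetti_map_neg_deg_one, neg_eq_iff_eq_neg, neg_smul]

/-- **A CM curve of `K`-type `(1,0)` has conjugate structure of type `(0,1)`**: for `dim E₀ = 1`, `ψ₀² = -d`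
(`d ≥ 1`) and `i√d` of multiplicity `1` on `H^{1,0}(E₀)` under `ψ₀^*`, the multiplicity of `i√d` on `H^{1,0}`
under `(-ψ₀)^*` is `0` (`dim V_{i√d} = 1 = p + q`, and conjugation exchanges `(p_{-μ}, q_{-μ}) = (q_μ, p_μ)`).
[cite: vanGeemen1994HodgeAV, 4.9 and 5.7] -/
theorem finrank_eigenspace_neg_inf_hodgeOneZero_eq_zero_of_curve (hE : E₀.dim = 1) (hd : 0 < d)
    (hψ₀ : ψ₀ ≫ ψ₀ = -(d • 𝟙 E₀))
    (h1 : Module.finrank ℂ ↥(Module.End.eigenspace (complexBetti.map ψ₀.hom.hom.hom 1).hom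
        (Complex.I * (Real.sqrt d : ℂ)) ⊓ hodgeOneZero (Motives.isSmoothProjective_of_dim_eq' hE)) = 1) :
    Module.finrank ℂ ↥(Module.End.eigenspace (complexBetti.map (-ψ₀).hom.hom.hom 1).hom
        (Complex.I * (Real.sqrt d : ℂ)) ⊓ hodgeOneZero (Motives.isSmoothProjective_of_dim_eq' hE)) = 0 := by
  haveI := finite_complexBetti_abelianVariety E₀ 1
  set μ : ℂ := Complex.I * (Real.sqrt d : ℂ) with hμ
  have hconj : (starRingEnd ℂ) (-μ) = μ := by
    rw [map_neg, hμ, map_mul, Complex.conj_I, Complex.conj_ofReal, neg_mul, neg_neg]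
  -- `dim V_μ = 1` on the curve
  have hV : Module.finrank ℂ ↥(Module.End.eigenspace (complexBetti.map ψ₀.hom.hom.hom 1).hom μ) = 1 := by
    have h := two_mul_finrank_eigenspace_eq hd hψ₀
    rw [finrank_complexBetti_one_of_dim_eq_one hE] at h
    change 2 * Module.finrank ℂ ↥(Module.End.eigenspace (complexBetti.map ψ₀.hom.hom.hom 1).hom μ) = 2 at h
    omega
  -- `p_μ + q_μ = dim V_μ`
  have hpq := finrank_eigenspace_eq_add (Motives.isSmoothProjective_of_dim_eq' hE) ψ₀.hom.hom.hom μ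
  rw [hV, h1] at hpq
  -- `p_{-μ} = q_{conj(-μ)} = q_μ`
  rw [eigenspace_map_neg_deg_one,
    ← finrank_eigenspace_inf_hodgeZeroOne_eq (Motives.isSmoothProjective_of_dim_eq' hE) ψ₀.hom.hom.hom (-μ),
    hconj]
  omega

/-- **Weil classes on a product of two threefolds, from Markman's fourfold theorem — multiplicities read on
the factors.**  `K = ℚ(√-d)` acting by `χ₁` on the threefold `Z₁` with `K`-type `(1,2)`, by `χ₂` on the
threefold `Z₂` with `K`-type `(2,1)`, and by `ψ₀` on the curve `E₀` with `K`-type `(1,0)` (multiplicities of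
`i√d` on `H^{1,0}`: `1`, `2`, `1`).  Then the elliptic completions `Z₁ × E`, `Z₂ × Ē` are fourfolds of Weil
type (multiplicities add: `1 + 1 = 2 + 0 = 2`), and, GIVEN `Markman2025_weilClasses_algebraic_abelianFourfold`,
every rational `(3,3)`-class of the Weil plane of the sixfold `(Z₁ × Z₂, χ₁ × χ₂)` (of Weil type `(3,3)`) is
algebraic.  [cite: Markman2025SurveySecant, Thm. 1.2 and §11.5 Step 2]
[cite: vanGeemen1994HodgeAV, 4.9 and proof of Lemma 5.2 (3)]
[cite: Schoen1998HodgeWeilAddendum, §10 (Proposition and proof, pp. 332–333)] -/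
theorem weilClasses_threefold_prod_threefold_of_markman_of_multiplicities
    (hW4 : Markman2025_weilClasses_algebraic_abelianFourfold)
    (hd : 0 < d) (hZ₁ : Z₁.dim = 3) (hZ₂ : Z₂.dim = 3) (hE : E₀.dim = 1)
    (hχ₁ : χ₁ ≫ χ₁ = -(d • 𝟙 Z₁)) (hχ₂ : χ₂ ≫ χ₂ = -(d • 𝟙 Z₂)) (hψ₀ : ψ₀ ≫ ψ₀ = -(d • 𝟙 E₀))
    (hm₁ : Module.finrank ℂ ↥(Module.End.eigenspace (complexBetti.map χ₁.hom.hom.hom 1).hom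
        (Complex.I * (Real.sqrt d : ℂ)) ⊓ hodgeOneZero (Motives.isSmoothProjective_of_dim_eq' hZ₁)) = 1)
    (hm₂ : Module.finrank ℂ ↥(Module.End.eigenspace (complexBetti.map χ₂.hom.hom.hom 1).hom
        (Complex.I * (Real.sqrt d : ℂ)) ⊓ hodgeOneZero (Motives.isSmoothProjective_of_dim_eq' hZ₂)) = 2)
    (hmE : Module.finrank ℂ ↥(Module.End.eigenspace (complexBetti.map ψ₀.hom.hom.hom 1).hom
        (Complex.I * (Real.sqrt d : ℂ)) ⊓ hodgeOneZero (Motives.isSmoothProjective_of_dim_eq' hE)) = 1) :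
    ∀ c : complexBetti (Z₁.prod Z₂).X (2 * 3), IsRationalClass c →
      IsOfHodgeType (2 * 3) (Z₁.prod Z₂).X (2 * 3) 3 3 c →
        c ∈ weilClassesOf (Z₁.prod Z₂)
          (prodLift (Motives.AbelianVariety.fst Z₁ Z₂ ≫ χ₁) (Motives.AbelianVariety.snd Z₁ Z₂ ≫ χ₂)) 3 d →
        c ∈ algebraicClasses (Z₁.prod Z₂).X 3 := by
  have hmE' := finrank_eigenspace_neg_inf_hodgeOneZero_eq_zero_of_curve hE hd hψ₀ hmE
  have hbal₁ := finrank_eigenspace_inf_hodgeOneZero_prod hZ₁ hE χ₁ ψ₀ (Complex.I * (Real.sqrt d : ℂ))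
  rw [hm₁, hmE] at hbal₁
  have hbal₂ := finrank_eigenspace_inf_hodgeOneZero_prod hZ₂ hE χ₂ (-ψ₀) (Complex.I * (Real.sqrt d : ℂ))
  rw [hm₂, hmE'] at hbal₂
  exact weilClasses_threefold_prod_threefold_of_markman hW4 hd hZ₁ hZ₂ hE hχ₁ hχ₂ hψ₀ hbal₁ hbal₂

/-- **The whole Weil plane of the sixfold `Z₁ × Z₂` consists of algebraic classes** (same hypotheses): the
product `(Z₁ × Z₂, χ₁ × χ₂)` is of Weil type `(3,3)` (multiplicities add: `1 + 2 = 3`), so its Weil plane is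
spanned by rational `(3,3)`-classes (`weilClassesOf_le_algebraicClasses_of_forall_isRationalClass`), each
algebraic by the previous theorem.  [cite: Markman2025SurveySecant, Thm. 1.2 and §11.5 Step 2]
[cite: vanGeemen1994HodgeAV, 4.9, 4.10 and proof of Lemma 5.2 (3)] -/
theorem weilClassesOf_threefold_prod_threefold_le_algebraicClasses_of_markman
    (hW4 : Markman2025_weilClasses_algebraic_abelianFourfold)
    (hd : 0 < d) (hZ₁ : Z₁.dim = 3) (hZ₂ : Z₂.dim = 3) (hE : E₀.dim = 1)
    (hχ₁ : χ₁ ≫ χ₁ = -(d • 𝟙 Z₁)) (hχ₂ : χ₂ ≫ χ₂ = -(d • 𝟙 Z₂)) (hψ₀ : ψ₀ ≫ ψ₀ = -(d • 𝟙 E₀))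
    (hm₁ : Module.finrank ℂ ↥(Module.End.eigenspace (complexBetti.map χ₁.hom.hom.hom 1).hom
        (Complex.I * (Real.sqrt d : ℂ)) ⊓ hodgeOneZero (Motives.isSmoothProjective_of_dim_eq' hZ₁)) = 1)
    (hm₂ : Module.finrank ℂ ↥(Module.End.eigenspace (complexBetti.map χ₂.hom.hom.hom 1).hom
        (Complex.I * (Real.sqrt d : ℂ)) ⊓ hodgeOneZero (Motives.isSmoothProjective_of_dim_eq' hZ₂)) = 2)
    (hmE : Module.finrank ℂ ↥(Module.End.eigenspace (complexBetti.map ψ₀.hom.hom.hom 1).hom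
        (Complex.I * (Real.sqrt d : ℂ)) ⊓ hodgeOneZero (Motives.isSmoothProjective_of_dim_eq' hE)) = 1) :
    weilClassesOf (Z₁.prod Z₂)
        (prodLift (Motives.AbelianVariety.fst Z₁ Z₂ ≫ χ₁) (Motives.AbelianVariety.snd Z₁ Z₂ ≫ χ₂)) 3 d ≤
      algebraicClasses (Z₁.prod Z₂).X 3 := by
  have hTd : (Z₁.prod Z₂).dim = 2 * 3 := by rw [Motives.AbelianVariety.dim_prod, hZ₁, hZ₂]
  have hφT := prodLift_comp_self_eq_neg_nsmul hχ₁ hχ₂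
  have hbalT := finrank_eigenspace_inf_hodgeOneZero_prod hZ₁ hZ₂ χ₁ χ₂ (Complex.I * (Real.sqrt d : ℂ))
  rw [hm₁, hm₂] at hbalT
  exact weilClassesOf_le_algebraicClasses_of_forall_isRationalClass (by norm_num) hTd hd hφT hbalT
    (weilClasses_threefold_prod_threefold_of_markman_of_multiplicities hW4 hd hZ₁ hZ₂ hE hχ₁ hχ₂ hψ₀
      hm₁ hm₂ hmE)

end Markman

end Literature.AlgebraicGeometry.HodgeTheory

end
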